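import Summits.QuantumFields.YangMills.Theorems.FluctuationComparisonRegPrIntLOrganTangentDwhiteOfLocalTubeOperator
import Mathlib.Analysis.Calculus.FDeriv.Linear
import HarnessLib

/-!
# Crux `FluctuationComparisonRegPrIntL` (stmt-QuantumFields-20520, rung R3), PATH-B organ (covariant organ of record, RULING №56) — (L61) «ONE TUBE LETTER PAIR FOR D0
# AND (xv)»: the D0 whitening door ✓(L60) `dwhite_of_localTubeOperator` took the complexified fluctuation operator's tube letters ENTRYWISE ((K-tube-holo)
# `DifferentiableOn ℂ (fun W => Kc W i j′)`, (K-bound) `‖Kc W i j′‖ ≤ a`), while the (xv) chain (✓p828173 ∕ ✓(L58) `norm_doubleDiff_inv_mul_le_of_tubeHolo(_coercive)`)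
# takes them in the `L²`-OPERATOR-NORM currency (`hK : DifferentiableOn ℂ K (cplxTube δ U)`, `hKM : ‖K W‖ ≤ M_K`).  This file proves the currency bridge (an entry is a
# norm-`≤ 1` linear functional of the `L²`-operator-normed matrix) and re-issues ✓(L60) ON ✓p828173's LETTER PAIR `(hK, hKM)` — so the D0 whitening side and
# (I-curv)'s (xv) corners now consume LITERALLY THE SAME two tube letters of ONE object `Kc`, plus (K-range), (K-real), (K-coer) = L2-a, (K-sqrt-decay) = L2-b.

Cell `ym3-torus` (YM ladder rung R3 = continuum `SU(2)` Yang–Mills on the three-torus — a RUNG: NOT d = 4, NOT infinite volume, NOT a mass gap, NOT Clay).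
Width seat `ym-ust-20520-w5` (gen 27), `--kind proof --supports stmt-QuantumFields-20520 --as helper`, count-neutral, DEFINITION-FREE, default heartbeats,
no registry ∕ binder ∕ `Lines/` edit.  Over ✓(L60) `…OrganTangentDwhiteOfLocalTubeOperator` (this seat), Mathlib `Matrix.Norms.L2Operator` (`Matrix.toEuclideanCLM`,
`Matrix.l2_opNorm_toEuclideanCLM`, `PiLp.norm_apply_le`, `PiLp.norm_single`), `LinearMap.mkContinuous`.

WHAT (sorry-free, def-free; `Matrix n n ℂ` normed FILE-LOCALLY by the scoped `L²`-operator family, as in ✓p828173 ∕ ✓(L58) ∕ ✓(L59) ∕ ✓(L60)).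
* §1 ★`norm_entry_le_of_l2_opNorm_le` — `‖A‖ ≤ M ⟹ ‖A i j‖ ≤ M` (`A i j = (A·e_j) i`, `‖(T x) i‖ ≤ ‖T x‖ ≤ ‖T‖·‖e_j‖`; the hypothesis-free form is the tree's
  `SolovayKitaev.norm_apply_le_norm`, whose module imports `Mathlib` whole — not imported); ★`differentiableOn_entry_of_l2Op` — `DifferentiableOn ℂ K s` (values in the
  `L²`-op-normed matrices) ⟹ `DifferentiableOn ℂ (fun W => K W i j) s` (the entry functional `LinearMap.mkContinuous 1`, composed).  [folklore]
* §2 ★★★`dwhite_of_tubeOperator_opNorm` — ✓(L60) `dwhite_of_localTubeOperator` with its entrywise pair `(hKc, hbd)` (and the bound `a`, `ha`) DELETED and ✓p828173's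
  pair in their place: `(hK : ∀ V, PlaqSmall (θBal …) V → DifferentiableOn ℂ Kc (cplxTube δt V))`, `(MK) (hMK : 0 ≤ MK) (hKM : ∀ V, PlaqSmall (θBal …) V → ∀ W ∈ cplxTube δt V,
  ‖Kc W‖ ≤ MK)`; the margin condition reads `2·(MK·e^{ρm r₀}·(mf·c₀(1,ρm)^ν))·R₁∕rt ≤ γK∕2`; CONCLUSION = ✓(L52)'s = ✓(L50b)'s `hDwhite` text VERBATIM.
NET: the tube letters of the organ are ONE pair `(hK, hKM)` on ONE object `Kc` — read by ✓(L58) for (xv)'s corners (with (K-real)×4 + (K-coer)×4) and by this file for D0's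
(Dwhite∣MW) (with (K-range), (K-real), (K-coer), (K-sqrt-decay), (Wh-read-K), (z-window∣MW)); UV3-NODE §92.2's L2-a ∕ L2-b ∕ L2-c are thereby the COMPLETE list of
analytic letters on this side, each in its printed currency.
INHABITATION (★★OWNER RULING №100): LAW-FREE — statements about the chart objects `Kc`, `K`, `Wh`, `coord`; no fibre law, no score, no cross-law object.

HONEST FRAMING: [folklore] functional analysis (a coordinate functional is bounded) + a re-issue between HYPOTHESIS letters; nothing of Bałaban's operators constructed or
asserted; (hK, hKM) = L2-c, (K-range), (K-real), (K-coer) = L2-a, (K-sqrt-decay) = L2-b, (Wh-read-K), (z-window∣MW) OPEN (D0 = 19200 EX ∧ V2′; [Balaban1985BackgroundPropagators]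
§3); (Dmin), (χ-Lip∣MW), (I-curv), (I-cov), KER′, rows v0.1–v0.4ᴱ UNDISCHARGED; the five registered stubs of `Lines/semiclassical_s2beta.lean`, crux 20520 and `YM3TorusSU2`
are NOT proved; registry untouched; rung R3 = SU(2) YM₃ on T³ — NOT d = 4, NOT infinite volume, NOT a mass gap, NOT Clay; the Yang–Mills mass gap is NOT proved.  [folklore]

References: T. Bałaban, CMP **109** (1987) 249–301 [Balaban1987RG1] ((1.5) p.261, (1.11)–(1.18) pp.262–263); CMP **99** (1985) 389–434 [Balaban1985BackgroundPropagators]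
((3.23)–(3.26) pp.394–395, Thm 3.4 p.400, Thm 3.11 p.416, p.428); CMP **96** (1984) 223–250 [Balaban1984PropagatorsII] (Lemma 2.1 (2.61) p.234); CMP **116** (1988)
1–22 [Balaban1988RG2Cluster] ((2.5)–(2.7) pp.12–13, p.15).
-/

set_option autoImplicit false

noncomputable section

namespace Summit.QuantumFields.YangMills.Theorems.OrganTangentDwhiteOfTubeOperatorOpNorm

open Function Set Metric Finset
open scoped NNReal Matrix Matrix.Norms.L2Operator
open Literature.MathematicalPhysics.QuantumFieldTheory
open Literature.MathematicalPhysics.QuantumFieldTheory.Balaban1983to89 T3ContinuumYM3Torus T3NestedUnitLaws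
  T3UnitLawDensityEML T4Continuum BalabanUVClass T3UnitScaleTilt T3LevelShift T3TiltDescent
open T4CubeChartExp (expPt)
open BalabanUVClass (CplxModel)
open Literature.MathematicalPhysics.QuantumFieldTheory.Balaban1983to89.B9Thm37GlueTorus (tdist1)
open Literature.MathematicalPhysics.QuantumFieldTheory.Balaban1983to89.B5TorusCover (UT)
open Literature.MathematicalPhysics.QuantumFieldTheory.Balaban1983to89.B13Sqrt27Accretive (invSqrt)
open Literature.MathematicalPhysics.QuantumFieldTheory.Balaban1983to89.B13RealSliceEntryLetters (realStructureComplex lam)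
open Literature.MathematicalPhysics.QuantumFieldTheory.Balaban1983to89.QGQInverse (Coercive)
open Summit.QuantumFields.YangMills.Theorems.OrganTangentDwhiteOfLocalTubeOperator (dwhite_of_localTubeOperator)

/-! ## §1 The currency bridge: entries of an `L²`-operator-normed matrix -/

section Bridge

variable {n : Type} [Fintype n] [DecidableEq n]

/-- ★ **ENTRIES ARE BOUNDED BY ANY `L²`-OPERATOR-NORM BOUND**: `‖A‖ ≤ M ⟹ ‖A i j‖ ≤ M` (`A i j = (A·e_j) i`, `‖(Tx) i‖ ≤ ‖Tx‖ ≤ ‖T‖·‖e_j‖ = ‖A‖ ≤ M`).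
The hypothesis-free `‖A i j‖ ≤ ‖A‖` is the tree's `Literature.Computability.QuantumComplexity.SolovayKitaev.norm_apply_le_norm` (not imported: that module imports
`Mathlib` whole); this is the consumer's shape (✓p828173's `hKM : ‖K W‖ ≤ M_K`). [folklore] [cite: Balaban1985BackgroundPropagators, Thm 3.4 p.400] -/
theorem norm_entry_le_of_l2_opNorm_le {A : Matrix n n ℂ} {M : ℝ} (hM : ‖A‖ ≤ M) (i j : n) : ‖A i j‖ ≤ M := by
  refine le_trans ?_ hM
  set T := Matrix.toEuclideanCLM (n := n) (𝕜 := ℂ) A with hTdef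
  have hT : ‖T‖ = ‖A‖ := Matrix.l2_opNorm_toEuclideanCLM A
  set x : EuclideanSpace ℂ n := WithLp.toLp 2 (Pi.single j (1:ℂ)) with hxdef
  have hx : ‖x‖ = 1 := by
    rw [hxdef, ← PiLp.single]
    rw [PiLp.norm_single, norm_one]
  have h1 : (T x) i = A i j := by
    rw [hxdef, hTdef, Matrix.toEuclideanCLM_toLp]
    show (A *ᵥ Pi.single j 1) i = A i j
    rw [Matrix.mulVec_single_one]; rfl
  calc ‖A i j‖ = ‖(T x) i‖ := by rw [h1]
    _ ≤ ‖T x‖ := PiLp.norm_apply_le _ _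
    _ ≤ ‖T‖ * ‖x‖ := T.le_opNorm x
    _ = ‖A‖ := by rw [hT, hx, mul_one]

/-- ★ **ENTRYWISE DIFFERENTIABILITY FROM `L²`-OPERATOR DIFFERENTIABILITY**: `DifferentiableOn ℂ K s` for `K : E → Matrix n n ℂ` (target normed by the `L²`-operator
norm) ⟹ `DifferentiableOn ℂ (fun W => K W i j) s` — the entry is a continuous linear functional (`LinearMap.mkContinuous 1` by `norm_entry_le_of_l2_opNorm_le le_rfl`). [folklore]
[cite: Balaban1987RG1, (1.5) p.261] -/
theorem differentiableOn_entry_of_l2Op {E : Type*} [NormedAddCommGroup E] [NormedSpace ℂ E]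
    {K : E → Matrix n n ℂ} {s : Set E} (hK : DifferentiableOn ℂ K s) (i j : n) :
    DifferentiableOn ℂ (fun W => K W i j) s := by
  let L : Matrix n n ℂ →ₗ[ℂ] ℂ :=
    { toFun := fun A => A i j, map_add' := fun A B => rfl, map_smul' := fun c A => rfl }
  have hL : ∀ A, ‖L A‖ ≤ 1 * ‖A‖ := fun A => by rw [one_mul]; exact norm_entry_le_of_l2_opNorm_le le_rfl i j
  let Lc : Matrix n n ℂ →L[ℂ] ℂ := L.mkContinuous 1 hL
  have : (fun W => K W i j) = fun W => Lc (K W) := rfl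
  rw [this]
  exact Lc.differentiable.comp_differentiableOn hK

end Bridge

/-! ## §2 (Dwhite∣MW) on ✓p828173's tube letter pair -/

section Dock

variable {ν : ℕ} {Nf : Fin ν → ℕ} [∀ i, NeZero (Nf i)]
variable {p : Type} [Fintype p] [DecidableEq p]

/-- ★★★ **(Dwhite∣MW) ON THE (xv) CHAIN'S TUBE LETTERS** — ✓(L60) `dwhite_of_localTubeOperator` with the entrywise pair `(hKc, hbd)` and `(a, ha)` DELETED and ✓p828173's
`L²`-operator-norm pair `(hK, hKM)` (one bound `MK ≥ 0`) in their place; margin condition `2·(MK·e^{ρm r₀}·(mf·c₀(1,ρm)^ν))·R₁∕rt ≤ γK∕2`; everything else VERBATIM;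
CONCLUSION = ✓(L52)'s = ✓`dlinkPath∕Square_of_dmin_dwhite`'s `hDwhite` text VERBATIM.  Proof: §1 ×2, then ✓(L60) by name with `a := MK`.
[cite: Balaban1987RG1, (1.11)-(1.18) pp.262-263; Balaban1985BackgroundPropagators, (3.23)-(3.26) pp.394-395, Thm 3.4 p.400, Thm 3.11 p.416, p.428; Balaban1984PropagatorsII, Lemma 2.1 (2.61) p.234; Balaban1988RG2Cluster, (2.5)-(2.7) pp.12-13, p.15] -/
theorem dwhite_of_tubeOperator_opNorm (F : T3Family) (γ b₀ p₀ : ℝ) (j Ts : ℕ) {Z : Type}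
    (Φ : GaugeField (F.P j) 0 ↥(Matrix.specialUnitaryGroup (Fin 2) ℂ) × Z → GaugeField (F.P Ts) 0 ↥(Matrix.specialUnitaryGroup (Fin 2) ℂ))
    (Wh : GaugeField (F.P j) 0 ↥(Matrix.specialUnitaryGroup (Fin 2) ℂ) → Z → PBond (F.P Ts) 0 → (Fin 3 → ℝ))
    (loc : p → UT Nf) (idx : PBond (F.P Ts) 0 → Fin 3 → p) (coord : Z → p → ℂ)
    (Kc : (PBond (F.P j) 0 → Matrix (Fin 2) (Fin 2) ℂ) → Matrix p p ℂ)
    (K : GaugeField (F.P j) 0 ↥(Matrix.specialUnitaryGroup (Fin 2) ℂ) → Matrix p p ℝ)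
    (δt rt : ℝ) (hrt0 : 0 < rt) (hrt : Real.exp (6 * rt) ≤ 1 + δt)
    -- ✓p828173's tube letter pair (L2-c), around every `θ_j`-small `V`
    (hK : ∀ V : GaugeField (F.P j) 0 ↥(Matrix.specialUnitaryGroup (Fin 2) ℂ), PlaqSmall (θBal F.L γ b₀ p₀ j) V →
      DifferentiableOn ℂ Kc ((CplxModel.specialUnitary (Fin 2)).cplxTube δt V))
    (MK : ℝ) (hMK : 0 ≤ MK)
    (hKM : ∀ V : GaugeField (F.P j) 0 ↥(Matrix.specialUnitaryGroup (Fin 2) ℂ), PlaqSmall (θBal F.L γ b₀ p₀ j) V →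
      ∀ W ∈ (CplxModel.specialUnitary (Fin 2)).cplxTube δt V, ‖Kc W‖ ≤ MK)
    -- (K-range); fibre multiplicity of `loc`; a summation rate `ρm > 0`
    (r₀ ρm : ℝ) (mf : ℕ) (hρm : 0 < ρm)
    (hfib : ∀ y : UT Nf, (univ.filter fun k => loc k = y).card ≤ mf)
    (hrange : ∀ V : GaugeField (F.P j) 0 ↥(Matrix.specialUnitaryGroup (Fin 2) ℂ), PlaqSmall (θBal F.L γ b₀ p₀ j) V →
      ∀ W ∈ (CplxModel.specialUnitary (Fin 2)).cplxTube δt V, ∀ i j', Kc W i j' ≠ 0 → tdist1 Nf (loc i) (loc j') ≤ r₀)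
    -- (K-coer): L2-a, REAL, at the `θ_j`-small centres
    (γK : ℝ) (hγK : 0 < γK)
    (hcoer : ∀ V : GaugeField (F.P j) 0 ↥(Matrix.specialUnitaryGroup (Fin 2) ℂ), PlaqSmall (θBal F.L γ b₀ p₀ j) V → Coercive (K V) γK)
    -- radii; the margin condition with the torus-size-free row sum
    (ρ B R₁ r δ₀ Zw : ℝ) (hB0 : 0 ≤ B) (hρ : 0 ≤ ρ) (hR₁ : 0 < R₁) (hR₁rt : R₁ ≤ rt)
    (hsmall : 2 * (MK * Real.exp (ρm * r₀) * (mf * B6.c0 1 ρm ^ ν)) * R₁ / rt ≤ γK / 2)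
    (hr0 : 0 < r) (hr1 : r < 1) (hZw : 0 ≤ Zw) (hδ₀R : δ₀ < r / (1 + r) * R₁ / 2)
    -- (K-real) and (K-sqrt-decay) on the enlarged window `θ_j + 4·√3·R₁`
    (hKreal : ∀ V' : GaugeField (F.P j) 0 ↥(Matrix.specialUnitaryGroup (Fin 2) ℂ), PlaqSmall (θBal F.L γ b₀ p₀ j + 4 * (Real.sqrt 3 * R₁)) V' →
      Kc ((CplxModel.specialUnitary (Fin 2)).embed V') = (K V').map (algebraMap ℝ ℂ))
    (hdec : ∀ V' : GaugeField (F.P j) 0 ↥(Matrix.specialUnitaryGroup (Fin 2) ℂ), PlaqSmall (θBal F.L γ b₀ p₀ j + 4 * (Real.sqrt 3 * R₁)) V' →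
      ∀ i j', ‖invSqrt ((K V').map (algebraMap ℝ ℂ)) i j'‖ ≤ B * Real.exp (-(ρ * tdist1 Nf (loc i) (loc j'))))
    -- (Wh-read-K)
    (hWh : ∀ V' : GaugeField (F.P j) 0 ↥(Matrix.specialUnitaryGroup (Fin 2) ℂ), PlaqSmall (θBal F.L γ b₀ p₀ j) V' →
      ∀ (z : Z) (e : PBond (F.P Ts) 0) (k : Fin 3), Wh V' z e k = ((invSqrt ((K V').map (algebraMap ℝ ℂ)) *ᵥ coord z) (idx e k)).re)
    -- (z-window∣MW) VERBATIM
    (hwin : ∀ (z : Z) (V : GaugeField (F.P j) 0 ↥(Matrix.specialUnitaryGroup (Fin 2) ℂ)) (b : PBond (F.P j) 0) (u : Fin 3 → ℝ), PlaqSmall (θBal F.L γ b₀ p₀ j) V →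
      PlaqSmall (θBal F.L γ b₀ p₀ j) (update V b (V b * expPt u)) → ‖u‖ ≤ δ₀ →
      (∀ r ∈ Set.Ioo (0:ℝ) 1, ∀ (n : ℕ) (hjn : j + 1 ≤ n) (hnK : n ≤ Ts), PlaqSmall (24 / 25 * θBal F.L γ b₀ p₀ n) (descendTo F ℰp n Ts hnK (Φ (update V b (V b * expPt (r • u)), z)))) →
      ∀ j', ‖coord z j'‖ ≤ Zw)
    (kW : PBond (F.P Ts) 0 → ℝ)
    (hkW : ∀ e k, (4 / (r / (1 + r) * R₁)) *
          (∑ j', (B ^ (1 - lam r) * (max B (2 / Real.sqrt (γK / 2))) ^ lam r) * Real.exp (-((1 - lam r) * ρ * tdist1 Nf (loc (idx e k)) (loc j')))) * Zw ≤ kW e) :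
    ∀ (z : Z) (V : GaugeField (F.P j) 0 ↥(Matrix.specialUnitaryGroup (Fin 2) ℂ)) (b : PBond (F.P j) 0) (u : Fin 3 → ℝ), PlaqSmall (θBal F.L γ b₀ p₀ j) V →
      PlaqSmall (θBal F.L γ b₀ p₀ j) (update V b (V b * expPt u)) → ‖u‖ ≤ δ₀ →
      (∀ r ∈ Set.Ioo (0:ℝ) 1, ∀ (n : ℕ) (hjn : j + 1 ≤ n) (hnK : n ≤ Ts), PlaqSmall (24 / 25 * θBal F.L γ b₀ p₀ n) (descendTo F ℰp n Ts hnK (Φ (update V b (V b * expPt (r • u)), z)))) →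
      ∀ e, ‖Wh (update V b (V b * expPt u)) z e - Wh V z e‖ ≤ kW e * ‖u‖ :=
  dwhite_of_localTubeOperator F γ b₀ p₀ j Ts Φ Wh loc idx coord Kc K δt rt hrt0 hrt
    (fun V hV i j' => differentiableOn_entry_of_l2Op (hK V hV) i j')
    r₀ MK ρm mf hMK hρm hfib hrange
    (fun V hV W hW i j' => norm_entry_le_of_l2_opNorm_le (hKM V hV W hW) i j')
    γK hγK hcoer ρ B R₁ r δ₀ Zw hB0 hρ hR₁ hR₁rt hsmall hr0 hr1 hZw hδ₀R hKreal hdec hWh hwin kW hkW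

end Dock

end Summit.QuantumFields.YangMills.Theorems.OrganTangentDwhiteOfTubeOperatorOpNorm

end
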